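import Summits.ValiantsHypothesis.ValiantsHypothesis.Theorems.DivisionGapDefs

/-!
# Crux `DivisionGap.PerDivisionHard` (stmt-ValiantsHypothesis-5065), line `pair-descent-jss-endpoint`
(v13.1) — stub `stub_matrixSplit`: row-ROABPs are row-split sums

`stub_matrixSplit`: if every entry of every matrix of the list `Ms₁` is a polynomial in the
variables `x_(r,c)` with `r ∈ A`, and every entry of every matrix of `Ms₂` one in the variables
with `r ∉ A`, then the `(s₀, t₀)` entry of `Ms₁.prod * Ms₂.prod` is `Σ_s f_s · g_s` with
`f_s := Ms₁.prod s₀ s` in the `A`-row variables and `g_s := Ms₂.prod s t₀` in the others.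

Proof.  The entry formula is `Matrix.mul_apply`.  The variable constraint "every monomial uses
only cells `e` with `e ∈ S`" says exactly that the polynomial lies in the subalgebra
`MvPolynomial.supported ℝ≥0 S` (`MvPolynomial.mem_supported`,
`MvPolynomial.mem_vars_iff_mem_support`), the matrices with all entries in a subsemiring form a
subsemiring of the matrix ring (`Subsemiring.matrix`), and a subsemiring is closed under list
products (`list_prod_mem`).
-/

noncomputable section

-- `Summit.ValiantsHypothesis.ValiantsHypothesis.…` is the tree's mandated single-conjunct layout
-- (Sub = Summit), so the duplicated namespace component is intended.
set_option linter.dupNamespace false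

namespace Summit.ValiantsHypothesis.ValiantsHypothesis.Theorems.DivisionGapPerDivisionHard

open MvPolynomial
open scoped NNReal

/-- A polynomial lies in the subalgebra `MvPolynomial.supported R S` of polynomials in the
variables of `S` iff every variable occurring in one of its monomials lies in `S`. [folklore] -/
theorem mem_supported_iff_forall_support {σ R : Type*} [CommSemiring R] (S : Set σ)
    (p : MvPolynomial σ R) :
    p ∈ MvPolynomial.supported R S ↔ ∀ mm ∈ p.support, ∀ e ∈ mm.support, e ∈ S := by
  rw [MvPolynomial.mem_supported]
  constructor
  · intro h mm hmm e he
    exact h ((MvPolynomial.mem_vars_iff_mem_support e).mpr ⟨mm, hmm, he⟩)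
  · intro h e he
    obtain ⟨mm, hmm, hem⟩ := (MvPolynomial.mem_vars_iff_mem_support e).mp he
    exact h mm hmm e hem

/-- If all entries of all matrices of a list lie in a subsemiring `T`, so do all entries of the
product of the list (the matrices with entries in `T` form the subsemiring `T.matrix`, which is
closed under list products). [folklore] -/
theorem listProd_matrix_apply_mem {ι R : Type*} [Fintype ι] [DecidableEq ι] [Semiring R]
    (T : Subsemiring R) (Ms : List (Matrix ι ι R)) (h : ∀ M ∈ Ms, ∀ a b, M a b ∈ T) (a b : ι) :
    Ms.prod a b ∈ T := by
  have hprod : Ms.prod ∈ (T.matrix : Subsemiring (Matrix ι ι R)) :=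
    list_prod_mem fun M hM => fun i j => h M hM i j
  exact hprod a b

/-- **`stub_matrixSplit` (registered sub-goal).  Row-ROABPs are row-split sums.**  If every entry
of every matrix of the list `Ms₁` is a polynomial in the variables `x_(r,c)` with `r ∈ A`, and
every entry of every matrix of `Ms₂` one in the variables with `r ∉ A`, then the `(s₀, t₀)` entry
of `Ms₁.prod * Ms₂.prod` is `Σ_s f_s · g_s` with `f_s := Ms₁.prod s₀ s` in the `A`-row variables
and `g_s := Ms₂.prod s t₀` in the others. [folklore] -/
theorem stub_matrixSplit :
    ∀ (n W : ℕ) (A : Finset (Fin n))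
      (Ms₁ Ms₂ : List (Matrix (Fin W) (Fin W) (MvPolynomial (Fin n × Fin n) ℝ≥0))) (s₀ t₀ : Fin W),
      (∀ M ∈ Ms₁, ∀ a b, ∀ mm ∈ (M a b).support, ∀ e ∈ mm.support, e.1 ∈ A) →
      (∀ M ∈ Ms₂, ∀ a b, ∀ mm ∈ (M a b).support, ∀ e ∈ mm.support, e.1 ∉ A) →
      ∃ f g : Fin W → MvPolynomial (Fin n × Fin n) ℝ≥0,
        (Ms₁.prod * Ms₂.prod) s₀ t₀ = ∑ s, f s * g s ∧
        (∀ s, ∀ mm ∈ (f s).support, ∀ e ∈ mm.support, e.1 ∈ A) ∧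
        (∀ s, ∀ mm ∈ (g s).support, ∀ e ∈ mm.support, e.1 ∉ A) := by
  intro n W A Ms₁ Ms₂ s₀ t₀ h₁ h₂
  refine ⟨fun s => Ms₁.prod s₀ s, fun s => Ms₂.prod s t₀, Matrix.mul_apply, fun s => ?_,
    fun s => ?_⟩
  · exact (mem_supported_iff_forall_support {e : Fin n × Fin n | e.1 ∈ A} _).mp
      (listProd_matrix_apply_mem (MvPolynomial.supported ℝ≥0 {e : Fin n × Fin n | e.1 ∈ A}).toSubsemiring
        Ms₁ (fun M hM a b => (mem_supported_iff_forall_support _ _).mpr (h₁ M hM a b)) s₀ s)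
  · exact (mem_supported_iff_forall_support {e : Fin n × Fin n | e.1 ∉ A} _).mp
      (listProd_matrix_apply_mem (MvPolynomial.supported ℝ≥0 {e : Fin n × Fin n | e.1 ∉ A}).toSubsemiring
        Ms₂ (fun M hM a b => (mem_supported_iff_forall_support _ _).mpr (h₂ M hM a b)) s t₀)

end Summit.ValiantsHypothesis.ValiantsHypothesis.Theorems.DivisionGapPerDivisionHard

end
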